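import Mathlib

/-! Twist-difference lemma (census CENSUS-r1-1-g6 §2, obstruction O-a): in ANY commutative ring, two
imprimitive divisibilities `C ∣ 2^m·D·G`, `C ∣ 2^m'·D'·G` whose auxiliary factors differ by a unit times a
divisor of `2` give the primitive one with one extra power of `2`.  No UFD / height-one localisation. -/

theorem twist_difference {A : Type*} [CommRing A] {C G D D' t : A} {u : Aˣ}
    (hDD : D - D' = (u : A) * t) (ht : t ∣ 2) {m m' : ℕ}
    (h1 : (2 : A) ^ m * D * G ∈ Ideal.span {C})
    (h2 : (2 : A) ^ m' * D' * G ∈ Ideal.span {C}) :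
    (2 : A) ^ (max m m' + 1) * G ∈ Ideal.span {C} := by
  obtain ⟨s, hs⟩ := ht
  set I := Ideal.span ({C} : Set A)
  obtain ⟨k, hk⟩ := Nat.exists_eq_add_of_le (le_max_left m m')
  obtain ⟨k', hk'⟩ := Nat.exists_eq_add_of_le (le_max_right m m')
  have h1' : (2 : A) ^ (max m m') * D * G ∈ I := by
    have h := I.mul_mem_left ((2 : A) ^ k) h1
    have e : (2 : A) ^ k * ((2 : A) ^ m * D * G) = (2 : A) ^ (max m m') * D * G := by
      rw [hk, pow_add]; ring
    rwa [e] at h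
  have h2' : (2 : A) ^ (max m m') * D' * G ∈ I := by
    have h := I.mul_mem_left ((2 : A) ^ k') h2
    have e : (2 : A) ^ k' * ((2 : A) ^ m' * D' * G) = (2 : A) ^ (max m m') * D' * G := by
      rw [hk', pow_add]; ring
    rwa [e] at h
  have hsub : (2 : A) ^ (max m m') * ((u : A) * t) * G ∈ I := by
    have h := I.sub_mem h1' h2'
    have e : (2 : A) ^ (max m m') * D * G - (2 : A) ^ (max m m') * D' * G
        = (2 : A) ^ (max m m') * (D - D') * G := by ring
    rwa [e, hDD] at h
  have h := I.mul_mem_left (s * (↑u⁻¹ : A)) hsub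
  have e : s * (↑u⁻¹ : A) * ((2 : A) ^ (max m m') * ((u : A) * t) * G)
      = (2 : A) ^ (max m m' + 1) * G := by
    calc s * (↑u⁻¹ : A) * ((2 : A) ^ (max m m') * ((u : A) * t) * G)
        = ((↑u⁻¹ : A) * (u : A)) * ((2 : A) ^ (max m m') * (t * s) * G) := by ring
      _ = (2 : A) ^ (max m m' + 1) * G := by rw [Units.inv_mul, ← hs, pow_succ]; ring
  rwa [e] at h

/-- Toy instance of the divisor-of-two input (`ζ = −1`, order `2`): `1 − ζ = 2 ∣ 2`. In the application
`D_c − D_{c,ν} = ε(c)·(1 − ν(c))·[σ_c]`, `ν(c) = ζ` a `2`-power root of unity `≠ 1`, `(1 − ζ) ∣ 2`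
because `Φ_{2^r}(1) = 2`. -/
example : ((1 : ℤ) - (-1)) ∣ 2 := by norm_num
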